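import Literature.Analysis.FluidPDE.DEIJCascadeMain
import Literature.Analysis.FluidPDE.DEIJDatumTruncation
import Literature.Analysis.FluidPDE.TurbPassiveScalar
import Literature.Analysis.FunctionSpaces.TorusScalarTrigPoly
import Literature.Analysis.FunctionSpaces.TorusSobolevNormEmbeddingProofs
import Literature.Analysis.FunctionSpaces.TorusInverseLaplacianL2
import HarnessLib

/-!
# Drivas–Elgindi–Iyer–Jeong, Theorem 2: anomalous dissipation for every mean-zero `H²` datum

Proof-support file for the discharge of `deij_anomalous_dissipation_eventually`
(`TurbPassiveScalar`): the passage from the smooth cascade data of `DEIJCascadeMain` to an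
arbitrary mean-zero `θ₀ ∈ H²(T^d)`. Everything is proved, nothing is defined; the `H²`
budget is the number `B(θ) = Σ_k (1+|k|²)²|θ̂(k)|²`.

* `integral_norm_hess_sq_le`: `∫‖hess g‖² ≤ Σᵢⱼ∫(∂ᵢ∂ⱼg)²` (the pointwise Hilbert–Schmidt bound
  `DEIJ.norm_hess_sq_le_sum` of `DEIJDatumTruncation`, integrated);
* the Fourier truncation `P_M θ = Torus.scalarTruncate M θ` (tree, `TorusScalarTrigPoly`):
  `integral_sq_partialDeriv_scalarTruncate` (`‖∂_pP_Mθ‖² = 4π²Σ_{B_M}k_p²|θ̂|²`, monotone in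
  `M`, bounded below by one mode), `integral_norm_hess_sq_scalarTruncate_le`
  (`∫‖hess P_Mθ‖² ≤ 16π⁴Σ_{B_M}|k|⁴|θ̂|²`); with the `H²` budget,
  `‖∇P_Mθ‖² ≤ 4π²B(θ)` and `∫‖hess P_Mθ‖² ≤ 16π⁴B(θ)` uniformly in `M`;
* **`deij_theorem2`**: for `d ≥ 2`, `α < 1`, `T > 0` and a mean-zero `θ₀ ∈ H²` there are a
  divergence-free field `u(θ₀)` — jointly smooth on `[0,T) × T^d`, in `C⁰_tC^α_x ∩ L¹_tC^α_x`,
  bounded — and `c(θ₀) > 0` with `κ∫₀ᵀ‖∇θ‖² ≥ c‖θ₀‖²_{L²}` for EVERY `κ > 0` and every weak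
  solution. Either all Fourier coefficients of `θ₀` vanish (then `‖θ₀‖_{L²} = 0` and `u = 0`
  serves), or some mode `k₀ ≠ 0` is present; then the cascade `DEIJ.CascadeData` is run from
  `P_Mθ₀` with the displaced coordinate `p₀`, `(k₀)_{p₀} ≠ 0`, the constants of
  `DEIJCascadeGrowth` being chosen from the `H²` budget and the single mode `k₀` (uniformly in
  `M`), and `M` so large that `‖θ₀ - P_Mθ₀‖²_{L²} ≤ 1/(8C₁²)` (Parseval tail).
  [cite: DrivasEtAl2022, Theorem 2, §3.3–3.4]

Deviations from the printed proof (recorded in the docstring of `deij_theorem2`): weak viscous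
solutions (criterion by duality, `DEIJCriterion`), `L²` phase selection instead of the `W^{1,∞}`
bootstrap, truncated datum, arbitrary dimension.

## References

* [DrivasEtAl2022] T. D. Drivas, T. M. Elgindi, G. Iyer, I.-J. Jeong, *Anomalous dissipation in
  passive scalar transport*, Arch. Ration. Mech. Anal. 243 (2022), arXiv:1911.03271, Theorem 2,
  Prop. 1.3, §3.
-/

noncomputable section

open MeasureTheory TopologicalSpace Set Function Filter Topology UnitAddTorus
open scoped ENNReal NNReal InnerProductSpace ContDiff
open Literature.Analysis.FunctionSpaces
open Literature.Analysis.FunctionSpaces.Torus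
open Literature.Analysis.FunctionSpaces.Torus renaming partialDeriv → tPartialDeriv

namespace Literature.Analysis.FluidPDE

namespace Torus

namespace DEIJ

variable {d : Type*} [Fintype d] [DecidableEq d]

/-! ## The Hessian in coordinates and its Hilbert–Schmidt bound -/

set_option maxSynthPendingDepth 2 in
/-- `∫ ‖hess g‖² ≤ Σᵢⱼ ∫ (∂ᵢ∂ⱼ g)²`. [folklore] -/
theorem integral_norm_hess_sq_le {g : UnitAddTorus d → ℝ} (hg : IsSmooth g) :
    ∫ x, ‖hess g x‖ ^ 2 ≤ ∑ i, ∑ j, ∫ x, tPartialDeriv i (tPartialDeriv j g) x ^ 2 := by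
  have hc : ∀ i j, Continuous fun x => tPartialDeriv i (tPartialDeriv j g) x := fun i j =>
    ((hg.partialDeriv j).partialDeriv i).continuous
  have hI : ∀ i j, Integrable (fun x => tPartialDeriv i (tPartialDeriv j g) x ^ 2) volume := fun i j =>
    ((hc i j).pow 2).integrable_unitAddTorus
  have e : ∑ i, ∑ j, ∫ x, tPartialDeriv i (tPartialDeriv j g) x ^ 2 = ∫ x, ∑ i, ∑ j, tPartialDeriv i (tPartialDeriv j g) x ^ 2 := by
    rw [integral_finsetSum _ fun i _ => integrable_finsetSum _ fun j _ => hI i j]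
    refine Finset.sum_congr rfl fun i _ => ?_
    rw [integral_finsetSum _ fun j _ => hI i j]
  rw [e]
  have hh : Continuous fun x => ‖hess g x‖ := (continuous_hess hg).norm
  exact integral_mono ((hh.pow 2).integrable_unitAddTorus)
    (integrable_finsetSum _ fun i _ => integrable_finsetSum _ fun j _ => hI i j) fun x => norm_hess_sq_le_sum hg x

/-! ## Derivatives of the Fourier truncation of a real scalar -/

section Truncation

variable (θ : UnitAddTorus d → ℝ)

/-- **The source of the truncation**: `‖∂_p P_M θ‖² = 4π² Σ_{k ∈ B_M} k_p² |θ̂(k)|²`. [folklore] -/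
theorem integral_sq_partialDeriv_scalarTruncate (M : ℕ) (p : d) :
    ∫ x, tPartialDeriv p (scalarTruncate M θ) x ^ 2 =
      4 * Real.pi ^ 2 * ∑ k ∈ freqBall M, (k p : ℝ) ^ 2 * ‖mFourierCoeff (fun x => (θ x : ℂ)) k‖ ^ 2 := by
  have e : (fun x => tPartialDeriv p (scalarTruncate M θ) x) =
      reTrigPoly (freqBall M) (fun k => (2 * Real.pi * Complex.I * (k p)) • mFourierCoeff (fun x => (θ x : ℂ)) k) :=
    funext fun x => partialDeriv_reTrigPoly _ _ p x
  have h := integral_sq_reTrigPoly (neg_mem_freqBall_of_mem (N := M)) ((isConjSymmScalar_mFourierCoeff θ).deriv p)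
  rw [show (∫ x, tPartialDeriv p (scalarTruncate M θ) x ^ 2) =
      ∫ x, reTrigPoly (freqBall M) (fun k => (2 * Real.pi * Complex.I * (k p)) • mFourierCoeff (fun x => (θ x : ℂ)) k) x ^ 2 by
    simp_rw [← e], h, Finset.mul_sum]
  refine Finset.sum_congr rfl fun k _ => ?_
  rw [norm_smul]
  simp [Complex.norm_real, Complex.norm_I, abs_of_pos Real.pi_pos, mul_pow]
  ring

/-- **The Hessian of the truncation**: `∫ ‖hess P_M θ‖² ≤ 16π⁴ Σ_{k ∈ B_M} |k|⁴ |θ̂(k)|²`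
(`integral_norm_hess_sq_le` and `sum_integral_sq_partialDeriv_partialDeriv_reTrigPoly`). [folklore] -/
theorem integral_norm_hess_sq_scalarTruncate_le (M : ℕ) :
    ∫ x, ‖hess (scalarTruncate M θ) x‖ ^ 2 ≤
      16 * Real.pi ^ 4 * ∑ k ∈ freqBall M, freqNormSq k ^ 2 * ‖mFourierCoeff (fun x => (θ x : ℂ)) k‖ ^ 2 := by
  refine (integral_norm_hess_sq_le (isSmooth_scalarTruncate M θ)).trans (le_of_eq ?_)
  unfold scalarTruncate
  exact sum_integral_sq_partialDeriv_partialDeriv_reTrigPoly (neg_mem_freqBall_of_mem (N := M))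
    (isConjSymmScalar_mFourierCoeff θ)

/-- The source of the truncation is monotone in the truncation level. [folklore] -/
theorem integral_sq_partialDeriv_scalarTruncate_mono (p : d) :
    Monotone fun M => ∫ x, tPartialDeriv p (scalarTruncate M θ) x ^ 2 := by
  intro M M' h
  simp only [integral_sq_partialDeriv_scalarTruncate]
  refine mul_le_mul_of_nonneg_left (Finset.sum_le_sum_of_subset_of_nonneg (freqBall_mono h)
    fun k _ _ => by positivity) (by positivity)

/-- A single mode bounds the source from below. [folklore] -/
theorem mode_le_integral_sq_partialDeriv_scalarTruncate (p : d) {k : d → ℤ} {M : ℕ} (hk : k ∈ freqBall M) :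
    4 * Real.pi ^ 2 * ((k p : ℝ) ^ 2 * ‖mFourierCoeff (fun x => (θ x : ℂ)) k‖ ^ 2) ≤
      ∫ x, tPartialDeriv p (scalarTruncate M θ) x ^ 2 := by
  rw [integral_sq_partialDeriv_scalarTruncate]
  refine mul_le_mul_of_nonneg_left ?_ (by positivity)
  exact Finset.single_le_sum (f := fun k => (k p : ℝ) ^ 2 * ‖mFourierCoeff (fun x => (θ x : ℂ)) k‖ ^ 2)
    (fun k _ => by positivity) hk

end Truncation

/-! ## The `H²` budget -/

omit [DecidableEq d] in
/-- For an `H²` scalar the weighted squares `(1 + |k|²)² |θ̂(k)|²` are summable. [folklore] -/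
theorem summable_weight_sq {θ : UnitAddTorus d → ℝ} (hθ : MemSobolev 2 (fun x => (θ x : ℂ))) :
    Summable fun k : d → ℤ => (1 + freqNormSq k) ^ 2 * ‖mFourierCoeff (fun x => (θ x : ℂ)) k‖ ^ 2 := by
  have h := hθ.summable_sobolevWeight_sq_mul_norm_sq
  refine h.congr fun k => ?_
  have h0 : 0 ≤ 1 + freqNormSq k := by linarith [freqNormSq_nonneg k]
  rw [sobolevWeight, show ((2 : ℝ) / 2) = 1 by norm_num, Real.rpow_one]

/-- The gradient of every truncation is within the `H²` budget `B(θ) = Σ_k (1+|k|²)²|θ̂(k)|²`: `‖∇P_M θ‖² ≤ 4π² B(θ)`. [folklore] -/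
theorem scalarGradNormSq_scalarTruncate_le {θ : UnitAddTorus d → ℝ} (hθ : MemSobolev 2 (fun x => (θ x : ℂ))) (M : ℕ) :
    scalarGradNormSq (scalarTruncate M θ) ≤
      4 * Real.pi ^ 2 * (∑' k : d → ℤ, (1 + freqNormSq k) ^ 2 * ‖mFourierCoeff (fun x => (θ x : ℂ)) k‖ ^ 2) := by
  rw [scalarGradNormSq, integral_norm_sq_gradient_scalarTruncate]
  refine mul_le_mul_of_nonneg_left ?_ (by positivity)
  refine (Finset.sum_le_sum fun k _ => ?_).trans
    ((summable_weight_sq hθ).sum_le_tsum (freqBall M) fun k _ => by positivity)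
  refine mul_le_mul_of_nonneg_right ?_ (sq_nonneg _)
  nlinarith [freqNormSq_nonneg k]

/-- The Hessian of every truncation is within the budget: `∫‖hess P_M θ‖² ≤ 16π⁴ B(θ)`. [folklore] -/
theorem integral_norm_hess_sq_scalarTruncate_le_budget {θ : UnitAddTorus d → ℝ}
    (hθ : MemSobolev 2 (fun x => (θ x : ℂ))) (M : ℕ) :
    ∫ x, ‖hess (scalarTruncate M θ) x‖ ^ 2 ≤
      16 * Real.pi ^ 4 * (∑' k : d → ℤ, (1 + freqNormSq k) ^ 2 * ‖mFourierCoeff (fun x => (θ x : ℂ)) k‖ ^ 2) := by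
  refine (integral_norm_hess_sq_scalarTruncate_le θ M).trans (mul_le_mul_of_nonneg_left ?_ (by positivity))
  refine (Finset.sum_le_sum fun k _ => ?_).trans
    ((summable_weight_sq hθ).sum_le_tsum (freqBall M) fun k _ => by positivity)
  refine mul_le_mul_of_nonneg_right ?_ (sq_nonneg _)
  nlinarith [freqNormSq_nonneg k]

/-! ## Anomalous dissipation for `H²` data with a nonzero mode -/

omit [DecidableEq d] in
/-- A real `L²` scalar all of whose Fourier coefficients vanish has `‖θ‖²_{L²} = 0`. [folklore] -/
theorem scalarL2Sq_eq_zero_of_forall {θ : UnitAddTorus d → ℝ} (hθ : MemLp θ 2 volume)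
    (h : ∀ k, mFourierCoeff (fun x => (θ x : ℂ)) k = 0) : scalarL2Sq θ = 0 := by
  have hs := hasSum_sq_norm_mFourierCoeff_ofReal hθ
  have h0 : (fun k : d → ℤ => ‖mFourierCoeff (fun x => (θ x : ℂ)) k‖ ^ 2) = fun _ => 0 := by
    funext k; rw [h k]; simp
  rw [h0] at hs
  exact (hasSum_zero.unique hs).symm ▸ rfl

/-- The trivial field serves a datum of vanishing `L²` norm. [folklore] -/
theorem exists_field_of_scalarL2Sq_eq_zero (α : ℝ≥0) (T : ℝ) {θ₀ : UnitAddTorus d → ℝ} (h0 : scalarL2Sq θ₀ = 0) :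
    ∃ u : ℝ → UnitAddTorus d → EuclideanSpace ℝ d,
      FunctionSpaces.Torus.IsSmoothSpaceTimeOn (Ico 0 T) u ∧ (∀ t ∈ Ico 0 T, IsDivFree (u t)) ∧
      ContinuousInHolderOn (Ico 0 T) α u ∧ MemLpHolder 1 α u (Ioo 0 T) ∧
      (∃ C : ℝ, ∀ t ∈ Ico 0 T, ∀ x, ‖u t x‖ ≤ C) ∧
      ∃ c : ℝ, 0 < c ∧ ∀ κ : ℝ, 0 < κ → ∀ θ : ℝ → UnitAddTorus d → ℝ,
        IsWeakScalarTransportOn T κ u θ₀ θ → ENNReal.ofReal (c * scalarL2Sq θ₀) ≤ eScalarDissipation κ θ 0 T := by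
  have hBHN : eBoundedHolderNorm α (fun _ : UnitAddTorus d => (0 : EuclideanSpace ℝ d)) = 0 := eBoundedHolderNorm_zero α
  have hMBH : MemBoundedHolder α (fun _ : UnitAddTorus d => (0 : EuclideanSpace ℝ d)) := memBoundedHolder_zero
  refine ⟨fun _ _ => 0, ?_, fun t _ x => ?_, ?_, ?_, ⟨0, fun t _ x => by simp⟩, 1, one_pos, fun κ _ θ _ => ?_⟩
  · exact FunctionSpaces.Torus.isSmoothSpaceTimeOn_const (isSmooth_const _) _
  · simp only [FunctionSpaces.Torus.divergence, FunctionSpaces.Torus.partialDeriv, FunctionSpaces.Torus.lineDeriv,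
      PiLp.zero_apply, deriv_const, Finset.sum_const_zero]
  · refine ⟨fun t _ => hMBH, fun t₀ _ => ?_⟩
    have e : (fun _ : ℝ => eBoundedHolderNorm α ((fun _ : UnitAddTorus d => (0 : EuclideanSpace ℝ d)) -
        fun _ : UnitAddTorus d => (0 : EuclideanSpace ℝ d))) = fun _ => 0 := by
      funext t; rw [sub_self]; exact eBoundedHolderNorm_zero α
    rw [e]; exact tendsto_const_nhds
  · refine ⟨Eventually.of_forall fun t => hMBH, ?_⟩
    unfold eLpHolderNorm
    have e : (fun _ : ℝ => boundedHolderNorm α (fun _ : UnitAddTorus d => (0 : EuclideanSpace ℝ d))) = fun _ => 0 := by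
      funext t; rw [boundedHolderNorm, hBHN, ENNReal.toReal_zero]
    rw [e, eLpNorm_zero']
    exact ENNReal.zero_lt_top
  · rw [h0, mul_zero, ENNReal.ofReal_zero]; exact zero_le

/-- **DEIJ Theorem 2 (all weak solutions, all `κ > 0`).** For `d ≥ 2`, `α < 1`, `T > 0` and every
mean-zero `θ₀ ∈ H²(T^d)` there are a divergence-free velocity field `u = u(θ₀)`, jointly smooth
on `[0,T) × T^d`, continuous in time with values in `C^α`, in `L¹_t C^α_x` and bounded, and a rate
`c = χ_α(θ₀) > 0` such that every weak solution of `∂ₜθ + u·∇θ = κΔθ`, `θ(0) = θ₀`, with any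
`κ > 0` satisfies `κ∫₀ᵀ‖∇θ‖² ≥ c‖θ₀‖²_{L²}`. Proof: the alternating smoothed-sawtooth cascade
`DEIJ.CascadeData` started from a Fourier truncation `P_M θ₀` (constants uniform in `M` by the
`H²` budget; the truncation error is absorbed by the balanced-growth criterion
`DEIJ.le_eScalarDissipation_of_balanced_growth`). Deviations from the printed proof: the
criterion is run for weak rather than classical viscous solutions (duality), the `W^{1,∞}`
bootstrap of Lemma 3.2 is replaced by an `L²` choice of the phase of each shear
(`DEIJ.exists_good_phase`), the datum is truncated, and the dimension is arbitrary (two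
coordinates `p₀ ≠ q₀`, the others passive). [cite: DrivasEtAl2022, Theorem 2, §3.3–3.4] -/
theorem deij_theorem2 (hd : 2 ≤ Fintype.card d) (α : ℝ≥0) (hα : α < 1) (T : ℝ) (hT : 0 < T)
    (θ₀ : UnitAddTorus d → ℝ) (hθ₀ : MemSobolev 2 (fun x => (θ₀ x : ℂ))) (hmean : HasZeroMean θ₀) :
    ∃ u : ℝ → UnitAddTorus d → EuclideanSpace ℝ d,
      FunctionSpaces.Torus.IsSmoothSpaceTimeOn (Ico 0 T) u ∧ (∀ t ∈ Ico 0 T, IsDivFree (u t)) ∧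
      ContinuousInHolderOn (Ico 0 T) α u ∧ MemLpHolder 1 α u (Ioo 0 T) ∧
      (∃ C : ℝ, ∀ t ∈ Ico 0 T, ∀ x, ‖u t x‖ ≤ C) ∧
      ∃ c : ℝ, 0 < c ∧ ∀ κ : ℝ, 0 < κ → ∀ θ : ℝ → UnitAddTorus d → ℝ,
        IsWeakScalarTransportOn T κ u θ₀ θ → ENNReal.ofReal (c * scalarL2Sq θ₀) ≤ eScalarDissipation κ θ 0 T := by
  classical
  have hL2 : MemLp θ₀ 2 volume := memLp_two_of_memSobolev (by norm_num) hθ₀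
  -- the degenerate case: all Fourier coefficients vanish
  by_cases hzero : ∀ k, mFourierCoeff (fun x => (θ₀ x : ℂ)) k = 0
  · exact exists_field_of_scalarL2Sq_eq_zero α T (scalarL2Sq_eq_zero_of_forall hL2 hzero)
  push Not at hzero
  obtain ⟨k₀, hk₀⟩ := hzero
  -- a direction in which the datum varies, and a second direction
  have hk₀ne : k₀ ≠ 0 := fun h => hk₀ (by rw [h]; exact mFourierCoeff_ofReal_zero_eq_zero hmean)
  obtain ⟨p₀, hp₀⟩ : ∃ p, k₀ p ≠ 0 := by
    by_contra h; push Not at h; exact hk₀ne (funext h)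
  obtain ⟨q₀, hq₀⟩ : ∃ q, q ≠ p₀ := Fintype.exists_ne_of_one_lt_card (by omega) p₀
  -- the time ratio `r = 2^m` with `α(m+1) < m`
  obtain ⟨m, hm⟩ : ∃ m : ℕ, (α : ℝ) / (1 - α) < m := exists_nat_gt _
  have hα1 : (α : ℝ) < 1 := by exact_mod_cast hα
  have hm1 : 1 ≤ m + 1 := by omega
  have hαm : (α : ℝ) * ((m + 1 : ℕ) + 1) < (m + 1 : ℕ) := by
    have h1 : 0 < 1 - (α : ℝ) := by linarith
    rw [div_lt_iff₀ h1] at hm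
    push_cast; nlinarith [α.2]
  -- the base frequency
  set r : ℝ := 2 ^ (m + 1) with hr
  have hr2 : 2 ≤ r := by
    have : (2 : ℝ) ^ 1 ≤ 2 ^ (m + 1) := pow_le_pow_right₀ (by norm_num) hm1
    simpa [hr] using this
  obtain ⟨N₀, hN₀⟩ : ∃ N₀ : ℕ, 16 * r / (T * (r - 1)) ≤ N₀ := exists_nat_ge _
  have hN₀' : 16 * (2 : ℝ) ^ (m + 1) ≤ T * (2 ^ (m + 1) - 1) * N₀ := by
    have hpos : 0 < T * (r - 1) := mul_pos hT (by linarith)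
    rw [div_le_iff₀ hpos] at hN₀
    rw [← hr]; linarith
  -- the truncation level: small `L²` error and the mode `k₀` included
  obtain ⟨M₁, hM₁⟩ := exists_mem_freqBall k₀
  set a₀ : ℝ := 4 * Real.pi ^ 2 * ((k₀ p₀ : ℝ) ^ 2 * ‖mFourierCoeff (fun x => (θ₀ x : ℂ)) k₀‖ ^ 2) with ha₀
  have ha₀pos : 0 < a₀ := by
    have h1 : (0 : ℝ) < (k₀ p₀ : ℝ) ^ 2 := by positivity
    have h2 : 0 < ‖mFourierCoeff (fun x => (θ₀ x : ℂ)) k₀‖ ^ 2 := by positivity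
    positivity
  -- uniform constants
  set B : ℝ := ∑' k : d → ℤ, (1 + freqNormSq k) ^ 2 * ‖mFourierCoeff (fun x => (θ₀ x : ℂ)) k‖ ^ 2 with hB
  have hB0 : 0 ≤ B := tsum_nonneg fun k => by positivity
  obtain ⟨hC0, -⟩ := ShearCascade.Cψ1_spec
  set ρ : ℝ := max (4 * Real.pi ^ 2 * B / a₀) 8 with hρ
  have hρ8 : 8 ≤ ρ := le_max_right _ _
  have hρ0' : 4 * Real.pi ^ 2 * B ≤ ρ * a₀ := by
    have h : 4 * Real.pi ^ 2 * B / a₀ ≤ ρ := le_max_left _ _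
    rwa [div_le_iff₀ ha₀pos] at h
  set νs : ℝ := 256 * (N₀ * (2 * r)) ^ 2 / a₀ with hνs
  have hνs0 : 0 ≤ νs := by positivity
  set Wc : ℝ := Real.sqrt (νs * ρ) with hWc
  have hWc0 : 0 ≤ Wc := Real.sqrt_nonneg _
  have hWc2 : Wc ^ 2 = νs * ρ := Real.sq_sqrt (by positivity)
  set Sst : ℝ := Real.sqrt (16 * Real.pi ^ 4 * B) with hSst
  set U : ℝ := max (max (2 * Sst / a₀) (2 * ShearCascade.Cψ1 * Wc)) 1 with hU
  have hU1 : 1 ≤ U := le_max_right _ _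
  have hUW : 2 * ShearCascade.Cψ1 * Wc ≤ U := (le_max_right _ _).trans (le_max_left _ _)
  have hUS' : 2 * Sst ≤ U * a₀ := by
    have h : 2 * Sst / a₀ ≤ U := (le_max_left _ _).trans (le_max_left _ _)
    rwa [div_le_iff₀ ha₀pos] at h
  set R : ℝ := 8 * U + 12 * ShearCascade.Cψ1 * Wc with hR
  set C₁ : ℝ := max ((Fintype.card d : ℝ) * R) 1 with hC₁
  have hC₁0 : 0 < C₁ := lt_of_lt_of_le one_pos (le_max_right _ _)
  have hC₁R : (Fintype.card d : ℝ) * R ≤ C₁ := le_max_left _ _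
  -- the truncation level
  have hsmall : ∀ᶠ M in atTop, ∫ x, (θ₀ x - scalarTruncate M θ₀ x) ^ 2 ≤ 1 / (8 * C₁ ^ 2) :=
    (tendsto_integral_sq_sub_scalarTruncate hL2).eventually (Iic_mem_nhds (by positivity))
  obtain ⟨M, hMδ, hMM₁⟩ := (hsmall.and (eventually_ge_atTop M₁)).exists
  have hkM : k₀ ∈ freqBall M := freqBall_mono hMM₁ hM₁
  -- the cascade datum
  have hsource : 0 < ∫ x, tPartialDeriv p₀ (scalarTruncate M θ₀) x ^ 2 :=
    lt_of_lt_of_le ha₀pos (mode_le_integral_sq_partialDeriv_scalarTruncate θ₀ p₀ hkM)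
  let D : CascadeData d :=
    { T := T, T_pos := hT, m := m + 1, one_le_m := hm1, N₀ := N₀, hN₀ := hN₀', p₀ := p₀, q₀ := q₀, hpq := hq₀.symm,
      g₀ := scalarTruncate M θ₀, smooth := isSmooth_scalarTruncate M θ₀, source_pos := hsource }
  have hDr : D.r = r := rfl
  have ha0 : a₀ ≤ D.a 0 := by
    rw [D.a_zero]; exact mode_le_integral_sq_partialDeriv_scalarTruncate θ₀ p₀ hkM
  have hPg0 : D.Pg 0 ≤ 4 * Real.pi ^ 2 * B := scalarGradNormSq_scalarTruncate_le hθ₀ M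
  have hS0 : D.S 0 ≤ Sst := Real.sqrt_le_sqrt (integral_norm_hess_sq_scalarTruncate_le_budget hθ₀ M)
  have hρ0 : D.Pg 0 ≤ ρ * D.a 0 := hPg0.trans (hρ0'.trans (mul_le_mul_of_nonneg_left ha0 (by linarith)))
  have hν0 : D.ν 0 * ρ ≤ Wc ^ 2 := by
    rw [hWc2]
    refine mul_le_mul_of_nonneg_right ?_ (by linarith)
    rw [D.ν_zero, hDr]
    show 256 * ((N₀ : ℝ) * (2 * r)) ^ 2 / D.a 0 ≤ νs
    rw [hνs]
    exact div_le_div_of_nonneg_left (by positivity) ha₀pos ha0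
  have hUS : 2 * D.S 0 ≤ U * D.a 0 := by
    calc 2 * D.S 0 ≤ 2 * Sst := by linarith
      _ ≤ U * a₀ := hUS'
      _ ≤ U * D.a 0 := mul_le_mul_of_nonneg_left ha0 (by linarith)
  -- the field and the rate
  have hL2pos : 0 < scalarL2Sq θ₀ := by
    have hs := hasSum_sq_norm_mFourierCoeff_ofReal hL2
    have h1 : ‖mFourierCoeff (fun x => (θ₀ x : ℂ)) k₀‖ ^ 2 ≤ ∫ x, θ₀ x ^ 2 :=
      le_hasSum hs k₀ fun k _ => sq_nonneg _
    have h2 : 0 < ‖mFourierCoeff (fun x => (θ₀ x : ℂ)) k₀‖ ^ 2 := by positivity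
    exact lt_of_lt_of_le h2 h1
  refine ⟨D.u, D.isSmoothSpaceTimeOn_u, fun t _ => D.isDivFree_u t, D.continuousInHolderOn_u hα, D.memLpHolder_u hα ?_,
    ⟨2 * ShearCascade.Cψ1, fun t _ x => D.norm_u_le t x⟩, 1 / (32 * C₁ ^ 2) / scalarL2Sq θ₀, by positivity, ?_⟩
  · exact hαm
  · intro κ hκ θ hθ
    rw [div_mul_cancel₀ _ hL2pos.ne']
    exact D.le_eScalarDissipation hρ8 hρ0 hWc0 hν0 hU1 hUS hUW le_rfl hC₁R hC₁0 hL2 hMδ hκ hθ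

end DEIJ

end Torus

end Literature.Analysis.FluidPDE
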